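import Summits.BirchSwinnertonDyer.BirchSwinnertonDyer.Theorems.KolyvaginRankRigidityAtTwoWalkEngineAdapter
import HarnessLib

/-!
# Crux U1 `KolyvaginBoundedDefectAtTwo` (stmt-BirchSwinnertonDyer-28083), LINE 17 `regular_core_rigidity` v3,
# stub S1b `stub_nearCoreExistenceAtTwo` — ENGINE ADAPTER III′: the adapter with classes typed in
# `galoisCohomology ((W⁄K).torsionGaloisModule 2^k) 1`

Width seat `bsd-line-krr2-p2` g14 (ONE READER on S1b); `--supports stmt-BirchSwinnertonDyer-28083` (helper). THEOREMS
ONLY; nothing here proves S1b, U1, a rung or BSD. BSD is NOT proved.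

`exists_regular_kolyvaginPrime_killing` (p691126) is stated with `galH1Torsion (W⁄K) 2^k` (an `abbrev` of the
carrier of `continuousCohomology`), whereas the vertices `H¹_{𝓕(c)}` and the localisations `loc_v` of the step-local
layer are typed over `galoisCohomology ((W⁄K).torsionGaloisModule 2^k) 1` (a `def` with `inferInstanceAs` instances).
The two types are definitionally equal but NOT reducibly, so instance search and `rw` do not cross between them.
**`exists_regular_kolyvaginPrime_killing_gc`** is the same theorem with every class typed in `galoisCohomology … 1`
(the `Finite` instance is transported by hand); the walk's step theorems should use this form and keep all frame
classes in `galoisCohomology … 1`. [cite: MazurRubin2004, §4.1, Prop. 4.1.5]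
Design: no definitions; `K : Type`; axioms `propext`, `Classical.choice`, `Quot.sound`.
-/

set_option autoImplicit false
-- the Theorems namespace of this sub repeats the summit name by design (D-0017 nested layout)
set_option linter.dupNamespace false

noncomputable section

open scoped Classical
open Function WeierstrassCurve Field Finset NumberField IsDedekindDomain
open Literature.NumberTheory Literature.NumberTheory.EllipticCurves Literature.NumberTheory.EllipticCurves.KolyvaginPairing
open Literature.NumberTheory.GaloisRepresentations

namespace Summit.BirchSwinnertonDyer.BirchSwinnertonDyer.Theorems.KolyvaginAtTwo.RegularValueEngine

variable {K : Type} [Field K] [NumberField K] (W : WeierstrassCurve ℚ)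

/-- **The engine adapter with classes typed in `galoisCohomology ((W⁄K).torsionGaloisModule 2^k) 1`** (the type of the
vertices `H¹_{𝓕(c)}` and of the source of `loc_v`); see `exists_regular_kolyvaginPrime_killing` (p691126) for the
content. [cite: MazurRubin2004, §4.1, Prop. 4.1.5] [cite: McCallumLMS1991, §3 Prop. 3.1] -/
theorem exists_regular_kolyvaginPrime_killing_gc [W.IsElliptic] [W.IsGloballyMinimal] [NeZero (W.conductorNorm ℤ)]
    (hK : IsImaginaryQuadratic K) (hodd : Odd (NumberField.discr K))
    (hH : SatisfiesHeegnerHypothesis (W.conductorNorm ℤ) K) {k : ℕ} (hk : 1 ≤ k)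
    (hρ2 : W.HasSurjectiveModNGaloisRep 2) (hsurj : W.HasSurjectiveModNGaloisRep ((2 ^ (k + 1) : ℕ) : ℤ))
    {τ : K ≃ₐ[ℚ] K} (hτ : τ ≠ 1)
    (S : AddSubgroup (galoisCohomology ((W.baseChange K).torsionGaloisModule ((2 ^ k : ℕ) : ℤ)) 1)) [Finite S]
    (hSτ : ∀ x ∈ S, conjAct W τ ((2 ^ k : ℕ) : ℤ) x ∈ S)
    {m : ℕ} (y : Fin m → galoisCohomology ((W.baseChange K).torsionGaloisModule ((2 ^ k : ℕ) : ℤ)) 1)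
    (hy : ∀ i, y i ∈ S)
    (sy : Fin m → ℤ) (hyτ : ∀ i, conjAct W τ ((2 ^ k : ℕ) : ℤ) (y i) = sy i • y i)
    {p q : galoisCohomology ((W.baseChange K).torsionGaloisModule ((2 ^ k : ℕ) : ℤ)) 1} (hp : p ∈ S) (hq : q ∈ S)
    {sp sq : ℤ}
    (hpτ : conjAct W τ ((2 ^ k : ℕ) : ℤ) p = sp • p) (hqτ : conjAct W τ ((2 ^ k : ℕ) : ℤ) q = sq • q) (bnd : ℕ) :
    ∃ ℓ : ℕ, bnd < ℓ ∧ Zhang2014.IsKolyvaginPrime (W.conductorNorm ℤ) W K 2 ℓ ∧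
      k + 1 ≤ Zhang2014.kolyvaginIndex W 2 ℓ ∧
      (∃ (v₁ : HeightOneSpectrum (𝓞 ℚ)) (𝔓₁ : Ideal (absIntegers (𝓞 ℚ) ℚ)) (h : absoluteGaloisGroup ℚ),
        (ℓ : 𝓞 ℚ) ∈ v₁.asIdeal ∧ 𝔓₁ ∈ v₁.primesAbove ∧ IsArithFrobAt (𝓞 ℚ) h 𝔓₁ ∧
        (∀ X : geomTorsion W ((2 ^ k : ℕ) : ℤ), h • h • X = X) ∧
        ∃ P : geomTorsion W ((2 ^ k : ℕ) : ℤ), (2 : ℤ) ^ (k - 1) • (P + h • P) ≠ 0) ∧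
      ∀ v : HeightOneSpectrum (𝓞 K), (ℓ : 𝓞 K) ∈ v.asIdeal →
        (∀ i, galoisCohomology.localization ((W.baseChange K).torsionGaloisModule ((2 ^ k : ℕ) : ℤ))
          (Sum.inr v : Place K) 1 (y i) = 0) ∧
        (∀ a : ℤ, a • galoisCohomology.localization ((W.baseChange K).torsionGaloisModule ((2 ^ k : ℕ) : ℤ))
            (Sum.inr v : Place K) 1 p = 0 ↔
          ∃ b : Fin m → ℤ, ∀ ρ ∈ torsionFixing (W.baseChange K) ((2 ^ (k + 1) : ℕ) : ℤ),
            h1Eval (W.baseChange K) ((2 ^ k : ℕ) : ℤ) (a • p - ∑ i, b i • y i) ρ = 0) ∧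
        (∀ a : ℤ, a • galoisCohomology.localization ((W.baseChange K).torsionGaloisModule ((2 ^ k : ℕ) : ℤ))
            (Sum.inr v : Place K) 1 q = 0 ↔
          ∃ b : Fin m → ℤ, ∀ ρ ∈ torsionFixing (W.baseChange K) ((2 ^ (k + 1) : ℕ) : ℤ),
            h1Eval (W.baseChange K) ((2 ^ k : ℕ) : ℤ) (a • q - ∑ i, b i • y i) ρ = 0) := by
  haveI : Finite (↥(show AddSubgroup (galH1Torsion (W.baseChange K) ((2 ^ k : ℕ) : ℤ)) from S)) := ‹Finite S›
  exact exists_regular_kolyvaginPrime_killing W hK hodd hH hk hρ2 hsurj hτ S hSτ y hy sy hyτ hp hq hpτ hqτ bnd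

end Summit.BirchSwinnertonDyer.BirchSwinnertonDyer.Theorems.KolyvaginAtTwo.RegularValueEngine

end
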